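import HarnessLib
import Literature.MathematicalPhysics.QuantumFieldTheory.Balaban1983to89.Beta.SliceLegsLeafK0
import Literature.MathematicalPhysics.QuantumFieldTheory.Balaban1983to89.B4Ineq115Torus

/-!
# Beta / LeafK123Clauses — the symmetry of `G_j^{resc}` (right legs ARE left legs) and ONE tower-concrete
# hypothesis package `BlockLegDecay` from which pv07's `LeafK123` follows for all three slice data

HONEST FRAMING (verbatim, page 1 of everything this cell writes): discharging `BetaPertH` makes Bałaban's UV
stability UNCONDITIONAL — a real constructive-QFT result; it is NOT the continuum limit and NOT the Clay problem.
ABSOLUTE RULE: no internally-minted statement enters as a cited fact; every hypothesis below is either kernel-proved in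
the tree or an explicit hypothesis of the theorem that uses it.  THIS MODULE asserts nothing printed: it is a
Mathlib-elementary certificate about Bałaban's concrete SCALAR (`U = 1`) torus tower `B1RG242Torus.tower P a m²`
(pv07), combining tree modules.  Zero cited facts; no estimate is proved here — only algebra (symmetry) and bookkeeping.
v1.0.1 = v1 (p181989) with a docstring-only DOCFIX (cf. XREAD pv27-g4 of `SliceLegsLeafK0`, GAPS G-pv27-3): the Context
quotation of [B4] Lemma 2.4 made verbatim and three tag locators aligned ((2.35) value + derivative block legs, (2.37)
fluctuation covariance); no declaration, statement or proof changed.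

WHERE THE LANE STANDS.  `Beta/SliceLegs` (p181750) + `Beta/SliceLegsLeafK0` (p181885) give the (W3a)₀ distance-form
tails of the three one-loop legs (MIXED `∂^ε_μ G^ε_k ∂^{εᵀ}_ν`, VALUE `ε^{−2}G^ε_k`, GRADIENT `ε^{−1}∂^ε_μ G^ε_k`) of the
scalar torus tower modulo pv07-g7's `B5Leaf237C0Torus.LeafK123 S (dataM | dataV | dataG P S a m²) c₀ δ₀′` = the
kernel bounds of [B4] Lemma 2.4 for THREE kernel families per level `1 ≤ j < k`: a LEFT block leg (`K1` resp. `K1v`),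
the fluctuation covariance (`K2`), and a RIGHT block leg (`K3` resp. `K3v`).

WHAT IS PROVED.
* §1 SYMMETRY (which `B5Display136Torus.spacing_mul_K3` explicitly did not use) is REUSED BY NAME from pv07-g7's
  `B4Ineq115Torus` (landed while this module was being written): `hOp_isSymm`, `EA_isSymm`,
  `avgMat_eq_smul_transpose`, `Marg_isSymm`, hence `Grs_isSymm` — `G_j^{resc} = (−Δ^{L^{−j}} + m_j² + a_jQ_j^*Q_j)^{−1}`
  is symmetric; here only the reading `Q_j = w_j·(Q_j^*)ᵀ`, `w_j = L^{−d·lvl j}` (`Qk_eq_smul_transpose`) and the weight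
  identity `L^{jd}·w_j = 1` for `j ≤ m + K` (`pow_mul_wj`).
* §2 RIGHT LEGS ARE LEFT LEGS read at the other variable, for Bałaban's levels `1 ≤ j ≤ m + K`:
  `K3 j ν ⟨j,y⟩ x′ = K1 j ν x′ ⟨j,y⟩` (`K3_eq_K1`: pv07's gradient legs) and `K3v j ν ⟨j,y⟩ x′ = K1v j ν x′ ⟨j,y⟩`
  (`K3v_eq_K1v`: the value legs of `SliceLegs`) — the weight `L^{jd}` of (1.136) cancels the averaging weight `L^{−jd}`.
* §3 ONE `S`-free, tower-concrete hypothesis package `BlockLegDecay P a m² c₀ δ₀′` (three fields, levels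
  `1 ≤ j ≤ m + K`, distances = pv07's sup torus distance `T` of `T^{(0)}` in `L^{−j}`-units to the block corner `fine y`):
  `ValDecay`  `|(G_j^{resc}Q_j^*)(x,y)| ≤ c₀e^{−δ₀′L^{−j}T(x, fine y)}`,
  `GradDecay` `|(∂^{L^{−j}}_μ G_j^{resc}Q_j^*)(x,y)| ≤ c₀e^{−δ₀′L^{−j}T(x, fine y)}`,
  `CovDecay`  `|C_j^{resc}(y,y′)| ≤ c₀e^{−δ₀′L^{−j}T(fine y, fine y′)}` (`C_j^{resc} = B5Display136Torus.Crs`, the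
  covariance rescaled to the unit lattice, `K2_eq`); monotone in the constants (`BlockLegDecay.mono`) and assembled from
  three separately-constanted families (`BlockLegDecay.of_three`).
* §4 `LeafK123` for `dataM`, `dataV`, `dataG` from `BlockLegDecay` (`leafK123_dataM/V/G`; level-`j` points by
  `K1_eq`/`K1v_eq`/`K2_eq` and §2, off-level points of the disjoint union by `atLevel_of_ne`).
* §5 COROLLARIES: the three β-road tails with the hypothesis `BlockLegDecay` (`mixedLeg_tail_of_blockLegDecay`,
  `valueLeg_tail_of_blockLegDecay`, `gradLeg_tail_of_blockLegDecay`).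
NET.  The one remaining supplier input of the an1 lane for the scalar torus tower is `BlockLegDecay P a m² c₀ δ₀′` with
`cK0 ≤ c₀`, `0 < δ₀′ ≤ dK0`, `(c₀, δ₀′)` free to depend on `(d, L, a)` (L is FIXED on the β road) but not on `j`, the
cutoff or the volume: TWO block-leg estimates (value and `L^{−j}`-lattice gradient of `G_j^{resc}Q_j^*`) and ONE
covariance estimate (`Crs_j`).  NOT provided here (located in the cell records, GAPS C-an1-21a): those estimates —
natively on `Site P ·` (pv07 lineage; the `K2` coercivity half is their node G-pv07-5e) or through a carrier dictionary
to pv23-g4 `Beta/TransportLeg.block_legs` and an5 `Beta/FluctuationCovariance.Cfl_entry_decay`.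

Context (not used in proofs).  [B4] p. 582, Lemma 2.4: «There exist positive constants c₀, δ₀, … such that
|(G_j(□)Q*_j)(x, y)|, |(∂^{L^{−j}}_μG_j(□)Q*_j)(x, y)| ≤ c₀e^{−δ₀|x−y|}, (2.35) … |C^{(j)}(□; y, y′)| ≤ c₀e^{−δ₀|y−y′|}, (2.37)»
(the derivative estimate is the second member of (2.35); (2.36) is the Hölder estimate, not used); [B5] p. 40 (1.136)
writes the right leg as «(Q′_jG′_j∂^{L^{−j}*}_ν)(y′, (L^jη)^{−1}x′)» with the weight L^{−jd} on the x′-sum, and (1.137)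
«applying the estimates (2.35)–(2.37) of Lemma 2.4 in [2] we obtain …».  B4 = [cite: Balaban1983RegularityDecay];
B5 = [cite: Balaban1984PropagatorsI]; B1 = [cite: Balaban1982Higgs1].
-/

namespace Literature.MathematicalPhysics.QuantumFieldTheory.Balaban1983to89

open Matrix

noncomputable section

namespace Beta.LeafK123Clauses

open B1RG242Torus
open B5Display136Torus (Grs Crs atLevel atLevel_mk atLevel_of_ne K1_eq K3_eq K2_eq)
open B5Ineq137Torus (T fine fineU dXU dUU T_nonneg)
open B5Leaf237C0Torus (LeafK123 cK0 dK0 decay_mono)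
open B4Ineq115Torus (wj Qk_eq avgMat_eq_smul_transpose Grs_isSymm)
open Beta.SliceLegs (dataM dataV dataG K1v K3v K1v_eq K3v_eq legConst)
open Beta.SliceLegsLeafK0 (c₀_nonneg_of_cK0_le mixedLeg_tail_of_K123 valueLeg_tail_of_K123 gradLeg_tail_of_K123)

/-! ## §3 (stated first). The hypothesis package: two block-leg families and the covariance family -/

/-- VALUE block-leg decay at Bałaban's levels `1 ≤ j ≤ m + K`: `|(G_j^{resc}Q_j^*)(x,y)| ≤ c·e^{−δL^{−j}T(x, fine y)}`
(the VALUE clause of (2.35) for the concrete torus tower, as a hypothesis shape; nothing printed is asserted).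
[cite: Balaban1983RegularityDecay, (2.35) p.582] -/
def ValDecay (P : Params) (a msq c δ : ℝ) : Prop :=
  ∀ j : ℕ, 1 ≤ j → j ≤ P.m + P.K → ∀ (x : Site P 0) (y : Site P j),
    |(Grs P a msq j * Qks P j) x y| ≤ c * Real.exp (-(δ * ((((P.L : ℝ) ^ j)⁻¹) * T P 0 x (fine P j y))))

/-- GRADIENT block-leg decay: `|(∂^{L^{−j}}_μ G_j^{resc}Q_j^*)(x,y)| ≤ c·e^{−δL^{−j}T(x, fine y)}`, where
`∂^{L^{−j}}_μ = L^j·∂¹_μ` (`B4Ineq115Torus.deriv_eps_div_spacing`) — the derivative member of (2.35) for the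
concrete torus tower, as a hypothesis shape. [cite: Balaban1983RegularityDecay, (2.35) p.582] -/
def GradDecay (P : Params) (a msq c δ : ℝ) : Prop :=
  ∀ j : ℕ, 1 ≤ j → j ≤ P.m + P.K → ∀ (μ : Fin P.d) (x : Site P 0) (y : Site P j),
    |(deriv P 0 (P.eps / P.spacing j) μ * Grs P a msq j * Qks P j) x y|
      ≤ c * Real.exp (-(δ * ((((P.L : ℝ) ^ j)⁻¹) * T P 0 x (fine P j y))))

/-- COVARIANCE decay: `|C_j^{resc}(y,y′)| ≤ c·e^{−δL^{−j}T(fine y, fine y′)}` for pv07's covariance rescaled to the unit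
lattice `Crs` ((2.37) for the concrete torus tower, as a hypothesis shape). [cite: Balaban1983RegularityDecay, (2.37) p.582] -/
def CovDecay (P : Params) (a msq c δ : ℝ) : Prop :=
  ∀ j : ℕ, 1 ≤ j → j ≤ P.m + P.K → ∀ (y y' : Site P j),
    |Crs P a msq j y y'| ≤ c * Real.exp (-(δ * ((((P.L : ℝ) ^ j)⁻¹) * T P 0 (fine P j y) (fine P j y'))))

/-- THE SUPPLIER PACKAGE of the an1 lane for the scalar torus tower: value block legs, gradient block legs, covariances,
with ONE pair of constants `(c₀, δ₀′)` for all levels `1 ≤ j ≤ m + K`. [folklore] -/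
structure BlockLegDecay (P : Params) (a msq c₀ δ₀' : ℝ) : Prop where
  val : ValDecay P a msq c₀ δ₀'
  grad : GradDecay P a msq c₀ δ₀'
  cov : CovDecay P a msq c₀ δ₀'

variable {P : Params} {S : B5.Setting}

/-! ## §1. Symmetry: `Q_j` is the weighted transpose of `Q_j^*` (the rest is pv07-g7's `B4Ineq115Torus`) -/

/-- `Q_j = w_j·(Q_j^*)ᵀ`, `w_j = L^{−d·lvl j}`: block averaging is the weighted transpose of block extension
(`B4Ineq115Torus.avgMat_eq_smul_transpose` read on `Qk`/`Qks`). [folklore] -/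
theorem Qk_eq_smul_transpose (j : ℕ) : Qk P j = wj P j • (Qks P j)ᵀ := by
  rw [Qk_eq, avgMat_eq_smul_transpose]
  rfl

/-! ## §2. Right legs are left legs -/

/-- `L^{jd}·w_j = 1` for Bałaban's levels `j ≤ m + K` (`w_j = L^{−d·lvl j}`, `lvl j = j`). [folklore] -/
theorem pow_mul_wj {j : ℕ} (hj : j ≤ P.m + P.K) : (P.L : ℝ) ^ (j * P.d) * wj P j = 1 := by
  rw [wj, lvl_of_le P hj, inv_pow, ← pow_mul, mul_comm P.d j, mul_inv_cancel₀ (pow_ne_zero _ P.cast_L_pos.ne')]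

/-- Transposing a sandwich `Q_j G_j^{resc} M` around the symmetric `G_j^{resc}`:
`(Q_j G_j^{resc} M)(y,x′) = w_j·(Mᵀ G_j^{resc} Q_j^*)(x′,y)`. [folklore] -/
theorem towerQk_Grs_mul_apply (a msq : ℝ) (j : ℕ) (M : Matrix (Site P 0) (Site P 0) ℝ) (y : Site P j)
    (x' : Site P 0) :
    ((tower P a msq).Qk j * Grs P a msq j * M) y x' = wj P j * (Mᵀ * Grs P a msq j * (tower P a msq).Qks j) x' y := by
  show (Qk P j * Grs P a msq j * M) y x' = wj P j * (Mᵀ * Grs P a msq j * Qks P j) x' y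
  have h : (Mᵀ * Grs P a msq j * Qks P j)ᵀ = (Qks P j)ᵀ * Grs P a msq j * M := by
    rw [Matrix.transpose_mul, Matrix.transpose_mul, Matrix.transpose_transpose, (Grs_isSymm (P := P) a msq j).eq,
      Matrix.mul_assoc]
  rw [Qk_eq_smul_transpose, Matrix.smul_mul, Matrix.smul_mul, Matrix.smul_apply, smul_eq_mul, ← h,
    Matrix.transpose_apply]

/-- The same without a right factor: `(Q_j G_j^{resc})(y,x′) = w_j·(G_j^{resc} Q_j^*)(x′,y)`. [folklore] -/
theorem towerQk_Grs_apply (a msq : ℝ) (j : ℕ) (y : Site P j) (x' : Site P 0) :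
    ((tower P a msq).Qk j * Grs P a msq j) y x' = wj P j * (Grs P a msq j * (tower P a msq).Qks j) x' y := by
  have h := towerQk_Grs_mul_apply (P := P) a msq j (1 : Matrix (Site P 0) (Site P 0) ℝ) y x'
  rwa [Matrix.mul_one, Matrix.transpose_one, Matrix.one_mul] at h

/-- **pv07's RIGHT gradient leg is its LEFT gradient leg at the other variable**:
`K3 j ν ⟨j,y⟩ x′ = K1 j ν x′ ⟨j,y⟩`, `1 ≤ j ≤ m + K`. [cite: Balaban1984PropagatorsI, (1.136) p.40] -/
theorem K3_eq_K1 {a msq : ℝ} (ha : 0 < a) (hm : 0 ≤ msq) {j : ℕ} (hj : 1 ≤ j) (hjm : j ≤ P.m + P.K)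
    (ν : Fin P.d) (y : Site P j) (x' : Site P 0) :
    B5Display136Torus.K3 P a msq j ν ⟨j, y⟩ x' = B5Display136Torus.K1 P a msq j ν x' ⟨j, y⟩ := by
  rw [K3_eq ha hm hj, K1_eq ha hm hj, towerQk_Grs_mul_apply, ← mul_assoc, pow_mul_wj hjm, one_mul,
    Matrix.transpose_transpose]

/-- **The RIGHT value leg of `SliceLegs` is its LEFT value leg at the other variable**:
`K3v j ν ⟨j,y⟩ x′ = K1v j ν x′ ⟨j,y⟩`, `1 ≤ j ≤ m + K`. [cite: Balaban1983RegularityDecay, (2.35) p.582] -/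
theorem K3v_eq_K1v {a msq : ℝ} (ha : 0 < a) (hm : 0 ≤ msq) {j : ℕ} (hj : 1 ≤ j) (hjm : j ≤ P.m + P.K)
    (ν : Fin P.d) (y : Site P j) (x' : Site P 0) :
    K3v P a msq j ν ⟨j, y⟩ x' = K1v P a msq j ν x' ⟨j, y⟩ := by
  rw [K3v_eq ha hm hj, K1v_eq ha hm hj, towerQk_Grs_apply, ← mul_assoc, pow_mul_wj hjm, one_mul]

/-! ## §3 (continued). Monotonicity and assembly of the package -/

/-- The three families are monotone in the constants. [folklore] -/
theorem ValDecay.mono {a msq c c' δ δ' : ℝ} (hc0 : 0 ≤ c) (hc : c ≤ c') (hδ : δ' ≤ δ) (h : ValDecay P a msq c δ) :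
    ValDecay P a msq c' δ' :=
  fun j hj hjm x y => decay_mono (mul_nonneg (inv_nonneg.mpr (pow_nonneg P.cast_L_pos.le j)) (T_nonneg P 0 _ _))
    hc hc0 hδ (h j hj hjm x y)

/-- [folklore] -/
theorem GradDecay.mono {a msq c c' δ δ' : ℝ} (hc0 : 0 ≤ c) (hc : c ≤ c') (hδ : δ' ≤ δ) (h : GradDecay P a msq c δ) :
    GradDecay P a msq c' δ' :=
  fun j hj hjm μ x y => decay_mono (mul_nonneg (inv_nonneg.mpr (pow_nonneg P.cast_L_pos.le j)) (T_nonneg P 0 _ _))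
    hc hc0 hδ (h j hj hjm μ x y)

/-- [folklore] -/
theorem CovDecay.mono {a msq c c' δ δ' : ℝ} (hc0 : 0 ≤ c) (hc : c ≤ c') (hδ : δ' ≤ δ) (h : CovDecay P a msq c δ) :
    CovDecay P a msq c' δ' :=
  fun j hj hjm y y' => decay_mono (mul_nonneg (inv_nonneg.mpr (pow_nonneg P.cast_L_pos.le j)) (T_nonneg P 0 _ _))
    hc hc0 hδ (h j hj hjm y y')

/-- `BlockLegDecay` is monotone in the constants. [folklore] -/
theorem BlockLegDecay.mono {a msq c c' δ δ' : ℝ} (hc0 : 0 ≤ c) (hc : c ≤ c') (hδ : δ' ≤ δ)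
    (h : BlockLegDecay P a msq c δ) : BlockLegDecay P a msq c' δ' :=
  ⟨h.val.mono hc0 hc hδ, h.grad.mono hc0 hc hδ, h.cov.mono hc0 hc hδ⟩

/-- Three families with their own constants give the package with `c₀ = max`, `δ₀′ = min`. [folklore] -/
theorem BlockLegDecay.of_three {a msq c₁ c₂ c₃ δ₁ δ₂ δ₃ : ℝ} (h₁ : 0 ≤ c₁) (h₂ : 0 ≤ c₂) (h₃ : 0 ≤ c₃)
    (hv : ValDecay P a msq c₁ δ₁) (hg : GradDecay P a msq c₂ δ₂) (hc : CovDecay P a msq c₃ δ₃) :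
    BlockLegDecay P a msq (max c₁ (max c₂ c₃)) (min δ₁ (min δ₂ δ₃)) :=
  ⟨hv.mono h₁ (le_max_left _ _) (min_le_left _ _),
   hg.mono h₂ ((le_max_left _ _).trans (le_max_right _ _)) ((min_le_right _ _).trans (min_le_left _ _)),
   hc.mono h₃ ((le_max_right _ _).trans (le_max_right _ _)) ((min_le_right _ _).trans (min_le_right _ _))⟩

/-! ## §4. `LeafK123` for the three slice data from the package -/

/-- Case analysis on the disjoint union of the unit lattices: level `j` versus the other levels. [folklore] -/
theorem sigma_cases {j : ℕ} {Q : ((i : ℕ) × Site P i) → Prop} (hlev : ∀ y : Site P j, Q ⟨j, y⟩)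
    (hoff : ∀ u : (i : ℕ) × Site P i, u.1 ≠ j → Q u) : ∀ u, Q u := by
  rintro ⟨i, y⟩
  by_cases h : i = j
  · subst h
    exact hlev y
  · exact hoff ⟨i, y⟩ h

/-- A vanishing kernel satisfies any decay bound with a nonnegative constant. [folklore] -/
theorem abs_zero_le_decay {c t : ℝ} (hc : 0 ≤ c) : |(0 : ℝ)| ≤ c * Real.exp t := by
  rw [abs_zero]; exact mul_nonneg hc (Real.exp_pos t).le

/-- The `K1` clause of `LeafK123` for pv07's gradient leg, on the whole disjoint union. [folklore] -/
theorem K1_clause {a msq c₀ δ₀' : ℝ} (ha : 0 < a) (hm : 0 ≤ msq) {j : ℕ} (hj : 1 ≤ j) (hjm : j ≤ P.m + P.K)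
    (hc : 0 ≤ c₀) (H : BlockLegDecay P a msq c₀ δ₀') (μ : Fin P.d) (x : Site P 0) :
    ∀ u : (i : ℕ) × Site P i, |B5Display136Torus.K1 P a msq j μ x u| ≤ c₀ * Real.exp (-(δ₀' * dXU P j x u)) := by
  refine sigma_cases (j := j) (fun y => ?_) (fun u hu => ?_)
  · show |B5Display136Torus.K1 P a msq j μ x ⟨j, y⟩|
      ≤ c₀ * Real.exp (-(δ₀' * ((((P.L : ℝ) ^ j)⁻¹) * T P 0 x (fine P j y))))
    rw [K1_eq ha hm hj]
    exact H.grad j hj hjm μ x y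
  · rw [B5Display136Torus.K1, atLevel_of_ne j _ u hu, mul_zero]
    exact abs_zero_le_decay hc

/-- The `K1` clause for the VALUE leg `K1v`. [folklore] -/
theorem K1v_clause {a msq c₀ δ₀' : ℝ} (ha : 0 < a) (hm : 0 ≤ msq) {j : ℕ} (hj : 1 ≤ j) (hjm : j ≤ P.m + P.K)
    (hc : 0 ≤ c₀) (H : BlockLegDecay P a msq c₀ δ₀') (μ : Fin P.d) (x : Site P 0) :
    ∀ u : (i : ℕ) × Site P i, |K1v P a msq j μ x u| ≤ c₀ * Real.exp (-(δ₀' * dXU P j x u)) := by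
  refine sigma_cases (j := j) (fun y => ?_) (fun u hu => ?_)
  · show |K1v P a msq j μ x ⟨j, y⟩| ≤ c₀ * Real.exp (-(δ₀' * ((((P.L : ℝ) ^ j)⁻¹) * T P 0 x (fine P j y))))
    rw [K1v_eq ha hm hj]
    exact H.val j hj hjm x y
  · rw [Beta.SliceLegs.K1v, atLevel_of_ne j _ u hu, mul_zero]
    exact abs_zero_le_decay hc

/-- The `K2` clause (shared by the three data). [folklore] -/
theorem K2_clause {a msq c₀ δ₀' : ℝ} (ha : 0 < a) (hm : 0 ≤ msq) {j : ℕ} (hj : 1 ≤ j) (hjm : j ≤ P.m + P.K)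
    (hc : 0 ≤ c₀) (H : BlockLegDecay P a msq c₀ δ₀') :
    ∀ u u' : (i : ℕ) × Site P i,
      |B5Display136Torus.K2 P a msq j u u'| ≤ c₀ * Real.exp (-(δ₀' * dUU P j u u')) := by
  refine sigma_cases (j := j) (fun y => ?_) (fun u hu u' => ?_)
  · refine sigma_cases (j := j) (fun y' => ?_) (fun u' hu' => ?_)
    · show |B5Display136Torus.K2 P a msq j ⟨j, y⟩ ⟨j, y'⟩|
        ≤ c₀ * Real.exp (-(δ₀' * ((((P.L : ℝ) ^ j)⁻¹) * T P 0 (fine P j y) (fine P j y'))))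
      rw [K2_eq ha hm hj]
      exact H.cov j hj hjm y y'
    · rw [B5Display136Torus.K2, atLevel_mk, atLevel_of_ne j _ u' hu', mul_zero]
      exact abs_zero_le_decay hc
  · rw [B5Display136Torus.K2, atLevel_of_ne j _ u hu, mul_zero]
    exact abs_zero_le_decay hc

/-- The `K3` clause for pv07's RIGHT gradient leg, through `K3_eq_K1`. [folklore] -/
theorem K3_clause {a msq c₀ δ₀' : ℝ} (ha : 0 < a) (hm : 0 ≤ msq) {j : ℕ} (hj : 1 ≤ j) (hjm : j ≤ P.m + P.K)
    (hc : 0 ≤ c₀) (H : BlockLegDecay P a msq c₀ δ₀') (ν : Fin P.d) (x' : Site P 0) :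
    ∀ u : (i : ℕ) × Site P i,
      |B5Display136Torus.K3 P a msq j ν u x'| ≤ c₀ * Real.exp (-(δ₀' * dXU P j x' u)) := by
  refine sigma_cases (j := j) (fun y => ?_) (fun u hu => ?_)
  · show |B5Display136Torus.K3 P a msq j ν ⟨j, y⟩ x'|
      ≤ c₀ * Real.exp (-(δ₀' * ((((P.L : ℝ) ^ j)⁻¹) * T P 0 x' (fine P j y))))
    rw [K3_eq_K1 ha hm hj hjm, K1_eq ha hm hj]
    exact H.grad j hj hjm ν x' y
  · rw [B5Display136Torus.K3, atLevel_of_ne j _ u hu, mul_zero]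
    exact abs_zero_le_decay hc

/-- The `K3` clause for the RIGHT value leg `K3v`, through `K3v_eq_K1v`. [folklore] -/
theorem K3v_clause {a msq c₀ δ₀' : ℝ} (ha : 0 < a) (hm : 0 ≤ msq) {j : ℕ} (hj : 1 ≤ j) (hjm : j ≤ P.m + P.K)
    (hc : 0 ≤ c₀) (H : BlockLegDecay P a msq c₀ δ₀') (ν : Fin P.d) (x' : Site P 0) :
    ∀ u : (i : ℕ) × Site P i, |K3v P a msq j ν u x'| ≤ c₀ * Real.exp (-(δ₀' * dXU P j x' u)) := by
  refine sigma_cases (j := j) (fun y => ?_) (fun u hu => ?_)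
  · show |K3v P a msq j ν ⟨j, y⟩ x'| ≤ c₀ * Real.exp (-(δ₀' * ((((P.L : ℝ) ^ j)⁻¹) * T P 0 x' (fine P j y))))
    rw [K3v_eq_K1v ha hm hj hjm, K1v_eq ha hm hj]
    exact H.val j hj hjm x' y
  · rw [Beta.SliceLegs.K3v, atLevel_of_ne j _ u hu, mul_zero]
    exact abs_zero_le_decay hc

/-- **`LeafK123 (dataM)`** — pv07's mixed data: `K1` gradient leg, `K2`, `K3 = K1` at the other variable.
[cite: Balaban1984PropagatorsI, (1.137) p.40] -/
theorem leafK123_dataM {a msq c₀ δ₀' : ℝ} (ha : 0 < a) (hm : 0 ≤ msq) (hkK : S.k ≤ P.m + P.K + 1) (hc : 0 ≤ c₀)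
    (H : BlockLegDecay P a msq c₀ δ₀') : LeafK123 S (dataM P S a msq) c₀ δ₀' := by
  intro j hj hjk
  have hjm : j ≤ P.m + P.K := by omega
  refine ⟨fun μ x u => ?_, fun u u' => ?_, fun ν u x' => ?_⟩
  · show |B5Display136Torus.K1 P a msq j μ x u| ≤ c₀ * Real.exp (-(δ₀' * dXU P j x u))
    exact K1_clause ha hm hj hjm hc H μ x u
  · show |B5Display136Torus.K2 P a msq j u u'| ≤ c₀ * Real.exp (-(δ₀' * dUU P j u u'))
    exact K2_clause ha hm hj hjm hc H u u'
  · show |B5Display136Torus.K3 P a msq j ν u x'| ≤ c₀ * Real.exp (-(δ₀' * dXU P j x' u))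
    exact K3_clause ha hm hj hjm hc H ν x' u

/-- **`LeafK123 (dataV)`** — the value data: `K1v`, `K2`, `K3v = K1v` at the other variable.
[cite: Balaban1983RegularityDecay, (2.35) p.582] -/
theorem leafK123_dataV {a msq c₀ δ₀' : ℝ} (ha : 0 < a) (hm : 0 ≤ msq) (hkK : S.k ≤ P.m + P.K + 1) (hc : 0 ≤ c₀)
    (H : BlockLegDecay P a msq c₀ δ₀') : LeafK123 S (dataV P S a msq) c₀ δ₀' := by
  intro j hj hjk
  have hjm : j ≤ P.m + P.K := by omega
  refine ⟨fun μ x u => ?_, fun u u' => ?_, fun ν u x' => ?_⟩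
  · show |K1v P a msq j μ x u| ≤ c₀ * Real.exp (-(δ₀' * dXU P j x u))
    exact K1v_clause ha hm hj hjm hc H μ x u
  · show |B5Display136Torus.K2 P a msq j u u'| ≤ c₀ * Real.exp (-(δ₀' * dUU P j u u'))
    exact K2_clause ha hm hj hjm hc H u u'
  · show |K3v P a msq j ν u x'| ≤ c₀ * Real.exp (-(δ₀' * dXU P j x' u))
    exact K3v_clause ha hm hj hjm hc H ν x' u

/-- **`LeafK123 (dataG)`** — the gradient data: pv07's `K1`, `K2`, the value right leg `K3v`.
[cite: Balaban1983RegularityDecay, (2.35)/(2.37) p.582] -/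
theorem leafK123_dataG {a msq c₀ δ₀' : ℝ} (ha : 0 < a) (hm : 0 ≤ msq) (hkK : S.k ≤ P.m + P.K + 1) (hc : 0 ≤ c₀)
    (H : BlockLegDecay P a msq c₀ δ₀') : LeafK123 S (dataG P S a msq) c₀ δ₀' := by
  intro j hj hjk
  have hjm : j ≤ P.m + P.K := by omega
  refine ⟨fun μ x u => ?_, fun u u' => ?_, fun ν u x' => ?_⟩
  · show |B5Display136Torus.K1 P a msq j μ x u| ≤ c₀ * Real.exp (-(δ₀' * dXU P j x u))
    exact K1_clause ha hm hj hjm hc H μ x u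
  · show |B5Display136Torus.K2 P a msq j u u'| ≤ c₀ * Real.exp (-(δ₀' * dUU P j u u'))
    exact K2_clause ha hm hj hjm hc H u u'
  · show |K3v P a msq j ν u x'| ≤ c₀ * Real.exp (-(δ₀' * dXU P j x' u))
    exact K3v_clause ha hm hj hjm hc H ν x' u

/-! ## §5. The three β-road tails from the package -/

/-- **MIXED LEG, hFtail shape, from `BlockLegDecay`** (`a = d`). [cite: Balaban1984PropagatorsI, (1.137) p.40] -/
theorem mixedLeg_tail_of_blockLegDecay {a msq : ℝ} (ha : 0 < a) (hm : 0 ≤ msq) (hk : 1 ≤ S.k)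
    (hkK : S.k ≤ P.m + P.K + 1) {c₀ δ₀' ā : ℝ} (hc : cK0 P.d P.L a msq ≤ c₀) (hδ : 0 < δ₀')
    (hδ' : δ₀' ≤ dK0 P.d P.L a msq) (hā : ∀ j, |B1.aSeq a P.L j| ≤ ā) (H : BlockLegDecay P a msq c₀ δ₀')
    (μ ν : Fin P.d) {x x' : Site P 0} (hx : x ≠ x') :
    |(deriv P 0 P.eps μ * (tower P a msq).G S.k * (deriv P 0 P.eps ν)ᵀ) x x'|
      ≤ legConst P c₀ δ₀' ā P.d / T P 0 x x' ^ P.d * Real.exp (-(3 / 8 * δ₀' / (P.L : ℝ) ^ S.k) * T P 0 x x')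
    ∧ |(deriv P 0 P.eps μ * (tower P a msq).G S.k * (deriv P 0 P.eps ν)ᵀ) x x'|
      ≤ legConst P c₀ δ₀' ā P.d / T P 0 x x' ^ P.d :=
  mixedLeg_tail_of_K123 ha hm hk hkK hc hδ hδ' hā
    (leafK123_dataM ha hm hkK (c₀_nonneg_of_cK0_le (P := P) ha hc) H) μ ν hx

/-- **VALUE LEG, hFtail / hGtail shapes, from `BlockLegDecay`** (`a = s = d − 2`).
[cite: Balaban1984PropagatorsI, (1.137) p.40] -/
theorem valueLeg_tail_of_blockLegDecay {a msq : ℝ} (ha : 0 < a) (hm : 0 ≤ msq) {s : ℕ} (hs : 1 ≤ s)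
    (hds : P.d = s + 2) (hk : 1 ≤ S.k) (hkK : S.k ≤ P.m + P.K + 1) {c₀ δ₀' ā : ℝ} (hc : cK0 P.d P.L a msq ≤ c₀)
    (hδ : 0 < δ₀') (hδ' : δ₀' ≤ dK0 P.d P.L a msq) (hā : ∀ j, |B1.aSeq a P.L j| ≤ ā)
    (H : BlockLegDecay P a msq c₀ δ₀') {x x' : Site P 0} (hx : x ≠ x') :
    |(P.eps ^ 2)⁻¹ * (tower P a msq).G S.k x x'|
      ≤ legConst P c₀ δ₀' ā s / T P 0 x x' ^ s * Real.exp (-(3 / 8 * δ₀' / (P.L : ℝ) ^ S.k) * T P 0 x x')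
    ∧ |(P.eps ^ 2)⁻¹ * (tower P a msq).G S.k x x'| ≤ legConst P c₀ δ₀' ā s / T P 0 x x' ^ s :=
  valueLeg_tail_of_K123 ha hm hs hds hk hkK hc hδ hδ' hā
    (leafK123_dataV ha hm hkK (c₀_nonneg_of_cK0_le (P := P) ha hc) H) hx

/-- **GRADIENT LEG, hFtail / hGtail shapes, from `BlockLegDecay`** (`a = s = d − 1`).
[cite: Balaban1984PropagatorsI, (1.137) p.40] -/
theorem gradLeg_tail_of_blockLegDecay {a msq : ℝ} (ha : 0 < a) (hm : 0 ≤ msq) {s : ℕ} (hs : 1 ≤ s)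
    (hds : P.d = s + 1) (hk : 1 ≤ S.k) (hkK : S.k ≤ P.m + P.K + 1) {c₀ δ₀' ā : ℝ} (hc : cK0 P.d P.L a msq ≤ c₀)
    (hδ : 0 < δ₀') (hδ' : δ₀' ≤ dK0 P.d P.L a msq) (hā : ∀ j, |B1.aSeq a P.L j| ≤ ā)
    (H : BlockLegDecay P a msq c₀ δ₀') (μ : Fin P.d) {x x' : Site P 0} (hx : x ≠ x') :
    |P.eps⁻¹ * (deriv P 0 P.eps μ * (tower P a msq).G S.k) x x'|
      ≤ legConst P c₀ δ₀' ā s / T P 0 x x' ^ s * Real.exp (-(3 / 8 * δ₀' / (P.L : ℝ) ^ S.k) * T P 0 x x')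
    ∧ |P.eps⁻¹ * (deriv P 0 P.eps μ * (tower P a msq).G S.k) x x'| ≤ legConst P c₀ δ₀' ā s / T P 0 x x' ^ s :=
  gradLeg_tail_of_K123 ha hm hs hds hk hkK hc hδ hδ' hā
    (leafK123_dataG ha hm hkK (c₀_nonneg_of_cK0_le (P := P) ha hc) H) μ hx

/-- Non-vacuity of the package's shape: the zero bound is an instance (all three families hold for any tower
whose kernels vanish — recorded only to show the quantifier structure elaborates; the tower's kernels do not vanish). -/
example {a msq : ℝ} : BlockLegDecay P a msq 0 0 → BlockLegDecay P a msq 1 0 :=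
  fun h => h.mono le_rfl zero_le_one le_rfl

end Beta.LeafK123Clauses

end

end Literature.MathematicalPhysics.QuantumFieldTheory.Balaban1983to89
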